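import Literature.NumberTheory.DiophantineGeometry.GenEllDeCriticalCollisions
import Mathlib.Data.Rat.Cast.CharZero
import HarnessLib

/-!
# [GenEll] Thm. 2.1 for `ℙ¹`, the `D_e` route: finitely many parameters `c` with pairwise disjoint
# persistent sets

S. Mochizuki, *Arithmetic elliptic curves in general position*, Math. J. Okayama Univ. 52 (2010)
[cite: MochizukiGenEll2010, Thm 2.1 p.12] (the noncritical Belyi map of the proof of Thm. 2.1 must
avoid the configuration at hand).  Sequel of `GenEllDeCriticalCollisions`: on the cover
`D_e : r^e = x(1−x)` (`e = 2k+1`) with the family of functions `t_c = 1/r + c·r^{k+1}/(1−2x)`, the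
PERSISTENT SET of `c` (`DeFamily.persistentSet k c`, the `x`-coordinates of non-special points that
collide under `t_c` with a `t_c`-critical point, i.e. the points no Belyi map built on `t_c` can
protect) is finite for `c ≠ 0`, and a fixed non-special point collides with critical points for only
finitely many `c`.  Here we draw the consequence the assembly needs (the «persistent family» spine of
the abc-iut cell's route item GenEllTwo of `Summit.ABC.ABC.Theses.IUTThetaPilot`, which pigeonholes the
`≤ 2d` algebraic entries of a configuration against `2d+1` family members):

* `DeFamily.collide_iff` — for non-special `P, Q`, `Collide k c P Q ↔ t_c(P) = t_c(Q)`;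
* `DeFamily.finite_badParams` — for a fixed `x`-value `a`, only finitely many RATIONAL `c` have `a` in
  the persistent set of `t_c` (in a given field `Ω` of characteristic `0`);
* `DeFamily.exists_params_pairwise_disjoint` — **for every `n` and any two fields `Ω₁, Ω₂` of
  characteristic `0` there are nonzero rationals `c₁, …, c_n` whose persistent sets are pairwise
  disjoint in `Ω₁` and in `Ω₂`** (`k ≥ 3`; the consumer takes `Ω₁ = ℂ`, `Ω₂ = Q̄₂`, `n = 2d+1`).

Theorems only; classical algebra; nothing here bears on the disputed parts of the abc-iut corpus.
-/

noncomputable section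

open Polynomial

namespace Literature.NumberTheory.DiophantineGeometry.GenEll

namespace DeFamily

variable {Ω : Type*} [Field Ω]

/-- For non-special `P, Q` the collision relation IS `t_c(P) = t_c(Q)` with
`t_c = 1/r + c·r^{k+1}/(1−2x)`. [cite: MochizukiGenEll2010, Thm 2.1 p.12] -/
theorem collide_iff (k : ℕ) (c : Ω) {P Q : Ω × Ω} (hP : NonSpecial P) (hQ : NonSpecial Q) :
    Collide k c P Q ↔
      P.2⁻¹ + c * P.2 ^ (k + 1) / (1 - 2 * P.1) = Q.2⁻¹ + c * Q.2 ^ (k + 1) / (1 - 2 * Q.1) := by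
  obtain ⟨hr, hs⟩ := hP
  obtain ⟨hr', hs'⟩ := hQ
  rw [inv_eq_one_div, inv_eq_one_div, div_add_div _ _ hr hs, div_add_div _ _ hr' hs',
    div_eq_div_iff (mul_ne_zero hr hs) (mul_ne_zero hr' hs')]
  unfold Collide
  constructor
  · intro h
    linear_combination (-1 : Ω) * h
  · intro h
    linear_combination (-1 : Ω) * h

/-- The points of `D_e(Ω)` with a given `x`-coordinate form a finite set (at most `e` values of `r`).
[cite: MochizukiGenEll2010, Thm 2.1 p.12] -/
theorem finite_onCurve_fst_eq (k : ℕ) (a : Ω) : Set.Finite {P : Ω × Ω | OnCurve k P ∧ P.1 = a} := by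
  classical
  have hne : (X ^ (2 * k + 1) - C (a * (1 - a)) : Ω[X]) ≠ 0 := X_pow_sub_C_ne_zero (by omega) _
  have himg := (X ^ (2 * k + 1) - C (a * (1 - a)) : Ω[X]).roots.toFinset.finite_toSet.image
    (fun r : Ω => ((a, r) : Ω × Ω))
  refine himg.subset ?_
  rintro P ⟨hP, rfl⟩
  refine ⟨P.2, ?_, rfl⟩
  rw [Finset.mem_coe, Multiset.mem_toFinset, mem_roots hne, IsRoot.def, eval_sub, eval_pow, eval_X,
    eval_C, hP, sub_self]

variable [CharZero Ω]

/-- For a fixed `x`-value `a ∈ Ω`, the set of parameters `c ∈ Ω` whose persistent set contains `a`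
is finite (union over the finitely many non-special points over `a` of their finite collision
parameter sets). [cite: MochizukiGenEll2010, Thm 2.1 p.12] -/
theorem finite_params_of_mem {k : ℕ} (hk : 3 ≤ k) (a : Ω) :
    Set.Finite {c : Ω | a ∈ persistentSet k c} := by
  refine ((finite_onCurve_fst_eq k a).biUnion fun P _ =>
    (show Set.Finite {c : Ω | NonSpecial P ∧ ∃ Q : Ω × Ω, OnCurve k Q ∧ N k c Q = 0 ∧
      Collide k c P Q} from ?_)).subset ?_
  · by_cases hns : NonSpecial P
    · exact (finite_collisionParams hk hns).subset fun c hc => hc.2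
    · exact (Set.finite_empty.subset fun c hc => (hns hc.1).elim)
  · rintro c ⟨P, hPa, hP, hns, Q, hQ, hN, hcol⟩
    simp only [Set.mem_iUnion, Set.mem_setOf_eq]
    exact ⟨P, ⟨hP, hPa⟩, hns, Q, hQ, hN, hcol⟩

/-- **Finitely many bad rational parameters for a given `x`-value**: for `a ∈ Ω` (`Ω` of
characteristic `0`) only finitely many `c ∈ ℚ` have `a ∈ persistentSet k c`.
[cite: MochizukiGenEll2010, Thm 2.1 p.12] -/
theorem finite_badParams {k : ℕ} (hk : 3 ≤ k) (a : Ω) :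
    Set.Finite {c : ℚ | a ∈ persistentSet k (c : Ω)} :=
  show (((↑) : ℚ → Ω) ⁻¹' {c : Ω | a ∈ persistentSet k c}).Finite from
    (finite_params_of_mem hk a).preimage Rat.cast_injective.injOn

/-- For a finite set `Z ⊆ Ω`, only finitely many rational `c` have a persistent set meeting `Z`.
[cite: MochizukiGenEll2010, Thm 2.1 p.12] -/
theorem finite_badParams_of_finite {k : ℕ} (hk : 3 ≤ k) {Z : Set Ω} (hZ : Z.Finite) :
    Set.Finite {c : ℚ | ∃ a ∈ Z, a ∈ persistentSet k (c : Ω)} := by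
  refine (hZ.biUnion fun a _ => finite_badParams hk a).subset ?_
  rintro c ⟨a, haZ, ha⟩
  simp only [Set.mem_iUnion, Set.mem_setOf_eq]
  exact ⟨a, haZ, ha⟩

end DeFamily

namespace DeFamily

/-- **(3) Finitely many parameters with pairwise disjoint persistent sets, `Finset` form.** For
`k ≥ 3`, any two fields `Ω₁, Ω₂` of characteristic `0` and every `n`, there is a set of `n` NONZERO
rationals whose persistent sets are pairwise disjoint in `Ω₁` and in `Ω₂` (induction: the rationals
excluded at each step form a finite set, and `ℚ` is infinite). [cite: MochizukiGenEll2010, Thm 2.1 p.12] -/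
theorem exists_finset_params_pairwise_disjoint {Ω₁ Ω₂ : Type*} [Field Ω₁] [CharZero Ω₁] [Field Ω₂]
    [CharZero Ω₂] {k : ℕ} (hk : 3 ≤ k) (n : ℕ) :
    ∃ s : Finset ℚ, s.card = n ∧ (0 : ℚ) ∉ s ∧
      (s : Set ℚ).Pairwise (fun c c' => Disjoint (persistentSet k (c : Ω₁)) (persistentSet k (c' : Ω₁))) ∧
      (s : Set ℚ).Pairwise (fun c c' => Disjoint (persistentSet k (c : Ω₂)) (persistentSet k (c' : Ω₂))) := by
  classical
  induction n with
  | zero => exact ⟨∅, rfl, by simp, by simp, by simp⟩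
  | succ n ih =>
    obtain ⟨s, hcard, h0, h₁, h₂⟩ := ih
    have hk2 : 2 ≤ k := by omega
    -- the bad rationals: 0, the old parameters, and those whose persistent set meets an old one
    have hne : ∀ c ∈ (s : Set ℚ), (c : ℚ) ≠ 0 := fun c hc h => h0 (h ▸ hc)
    have hbad₁ : Set.Finite {q : ℚ | ∃ c ∈ (s : Set ℚ), ∃ a ∈ persistentSet k (c : Ω₁),
        a ∈ persistentSet k (q : Ω₁)} := by
      refine ((s.finite_toSet).biUnion fun c hc => finite_badParams_of_finite (Ω := Ω₁) hk
        (finite_persistentSet hk2 (Rat.cast_ne_zero.mpr (hne c hc)))).subset ?_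
      rintro q ⟨c, hc, a, ha, ha'⟩
      simp only [Set.mem_iUnion, Set.mem_setOf_eq]
      exact ⟨c, hc, a, ha, ha'⟩
    have hbad₂ : Set.Finite {q : ℚ | ∃ c ∈ (s : Set ℚ), ∃ a ∈ persistentSet k (c : Ω₂),
        a ∈ persistentSet k (q : Ω₂)} := by
      refine ((s.finite_toSet).biUnion fun c hc => finite_badParams_of_finite (Ω := Ω₂) hk
        (finite_persistentSet hk2 (Rat.cast_ne_zero.mpr (hne c hc)))).subset ?_
      rintro q ⟨c, hc, a, ha, ha'⟩
      simp only [Set.mem_iUnion, Set.mem_setOf_eq]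
      exact ⟨c, hc, a, ha, ha'⟩
    obtain ⟨q, hq⟩ := Infinite.exists_notMem_finset
      (insert (0 : ℚ) s ∪ (hbad₁.toFinset ∪ hbad₂.toFinset))
    simp only [Finset.mem_union, Finset.mem_insert, Set.Finite.mem_toFinset, Set.mem_setOf_eq,
      not_or, not_exists, not_and] at hq
    obtain ⟨⟨hq0, hqs⟩, hq₁, hq₂⟩ := hq
    refine ⟨insert q s, by rw [Finset.card_insert_of_notMem hqs, hcard], ?_, ?_, ?_⟩
    · rw [Finset.mem_insert, not_or]; exact ⟨Ne.symm hq0, h0⟩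
    · rw [Finset.coe_insert, Set.pairwise_insert_of_notMem (by exact_mod_cast hqs)]
      refine ⟨h₁, fun c hc => ?_⟩
      have hd : Disjoint (persistentSet k (q : Ω₁)) (persistentSet k (c : Ω₁)) :=
        Set.disjoint_left.mpr fun a haq hac => hq₁ c hc a hac haq
      exact ⟨hd, hd.symm⟩
    · rw [Finset.coe_insert, Set.pairwise_insert_of_notMem (by exact_mod_cast hqs)]
      refine ⟨h₂, fun c hc => ?_⟩
      have hd : Disjoint (persistentSet k (q : Ω₂)) (persistentSet k (c : Ω₂)) :=
        Set.disjoint_left.mpr fun a haq hac => hq₂ c hc a hac haq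
      exact ⟨hd, hd.symm⟩

/-- **(3) Pairwise disjoint persistent family, indexed form.** For `k ≥ 3`, two fields `Ω₁, Ω₂` of
characteristic `0` and every `n` there are `c : Fin n → ℚ`, all nonzero, whose persistent sets
`persistentSet k (c i)` are pairwise disjoint in `Ω₁` and in `Ω₂` — the `(Pers, hPcop)`-input of the
cell's persistent-family spine (which takes `n = 2d+1`, `Ω₁ = ℂ`, `Ω₂ = Q̄₂`).
[cite: MochizukiGenEll2010, Thm 2.1 p.12] -/
theorem exists_params_pairwise_disjoint {Ω₁ Ω₂ : Type*} [Field Ω₁] [CharZero Ω₁] [Field Ω₂]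
    [CharZero Ω₂] {k : ℕ} (hk : 3 ≤ k) (n : ℕ) :
    ∃ c : Fin n → ℚ, (∀ i, c i ≠ 0) ∧ Function.Injective c ∧
      Pairwise (fun i j => Disjoint (persistentSet k (c i : Ω₁)) (persistentSet k (c j : Ω₁))) ∧
      Pairwise (fun i j => Disjoint (persistentSet k (c i : Ω₂)) (persistentSet k (c j : Ω₂))) := by
  classical
  obtain ⟨s, hcard, h0, h₁, h₂⟩ :=
    exists_finset_params_pairwise_disjoint (Ω₁ := Ω₁) (Ω₂ := Ω₂) hk n
  let e : Fin n ≃ s := (s.equivFinOfCardEq hcard).symm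
  refine ⟨fun i => (e i : ℚ), fun i h => h0 (h ▸ (e i).2), ?_, ?_, ?_⟩
  · intro i j h
    exact e.injective (Subtype.ext h)
  · intro i j hij
    exact h₁ (e i).2 (e j).2 (fun h => hij (e.injective (Subtype.ext h)))
  · intro i j hij
    exact h₂ (e i).2 (e j).2 (fun h => hij (e.injective (Subtype.ext h)))

end DeFamily

end Literature.NumberTheory.DiophantineGeometry.GenEll
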